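import Literature.Analysis.FluidPDE.DEIJShearStage
import Literature.Analysis.FunctionSpaces.TorusScalarTrigPoly
import Literature.Analysis.FunctionSpaces.TorusSobolevNormEmbeddingProofs
import HarnessLib

/-!
# The smooth datum of the DEIJ cascade: Fourier truncation of a mean-zero `H²` scalar on `T^d`

Analysis/FluidPDE proof-support file (everything proved; no named facts) for the discharge of
`Literature.Analysis.FluidPDE.deij_anomalous_dissipation_eventually` /
`Literature.Analysis.FluidPDE.deij_anomalous_dissipation` (`TurbPassiveScalar`; Drivas–Elgindi–
Iyer–Jeong, ARMA 243 (2022), Thm. 2) through the balanced-growth criterion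
`Torus.DEIJ.le_eScalarDissipation_of_balanced_growth` (`DEIJCriterion`) and the shear stages of
`DEIJShearStage`. The criterion compares an arbitrary weak viscous solution with datum
`θ₀ ∈ H²(T^d)` to a smooth *inviscid* solution `g` whose datum `g(0)` need only be `L²`-close to
`θ₀`: `‖θ₀ - g(0)‖²_{L²} ≤ 1/(8C²)`, `C` the balanced-growth constant of `g`. For the
alternating-shear cascade started from a trigonometric polynomial `g(0)` of degree `N` one gets
`C ≲ (‖D²g(0)‖_{L²}/‖∇g(0)‖²_{L²} + const)`, i.e. `C = O(N²)/‖g(0)‖_{L²}`, so the datum must be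
approximated to `o(N⁻²)` in `L²` by degree-`N` trigonometric polynomials — exactly what
`θ₀ ∈ H²` buys (DEIJ, §3.3–3.4: the datum is split into an explicitly evolved part and an
`L²`-small remainder). This file supplies that datum, the Fourier truncation
`P_N θ₀ = Re ∑_{|k| ≤ N} θ̂₀(k) e_k` of `TorusScalarTrigPoly` (`FunctionSpaces.Torus.scalarTruncate`),
with what the assembly needs beyond that file:

* `Torus.DEIJ.memLp_two_of_memSobolev` — an `H^s` real scalar (`s ≥ 0`) is in `L²`;
* `Torus.DEIJ.hasZeroMean_scalarTruncate` — `P_N θ` has zero mean when `θ` has;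
* `Torus.DEIJ.integral_sq_scalarTruncate_add` — `∫ θ² = ∫ (P_Nθ)² + ∫ (θ - P_Nθ)²`;
* **the `H²` tail estimate** `Torus.DEIJ.tendsto_pow_four_mul_integral_sq_sub_scalarTruncate`:
  `N⁴ ∫ (θ - P_Nθ)² → 0` for `θ ∈ H²` (`N⁴ ∑_{|k|>N} |θ̂(k)|² ≤ ∑_{|k|>N} ⟨k⟩⁴|θ̂(k)|²`, the
  tail of the convergent `H²` series);
* the Poincaré inequality `4π² ∫ (P_Nθ)² ≤ ‖∇P_Nθ‖²_{L²}` for mean-zero `θ`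
  (`Torus.DEIJ.four_pi_sq_mul_integral_sq_scalarTruncate_le`), a dominant coordinate
  `‖∇g‖²_{L²} ≤ d · ∫ (∂_p g)²` (`Torus.DEIJ.exists_dominant_coordinate`), and
* **the Hessian bound** `∫ ‖hess (P_Nθ)‖² ≤ 16π⁴ N⁴ ∫ (P_Nθ)²`
  (`Torus.DEIJ.integral_norm_hess_scalarTruncate_sq_le`) in the operator-norm currency of
  `Torus.DEIJ.hess` (`DEIJShearStage`): all mixed second partials are Hessian entries
  (`partialDeriv_partialDeriv_eq_hess'`), the operator norm of a bilinear form on `ℝ^d` is at most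
  its Hilbert–Schmidt norm (`norm_bilin_le_sqrt_sum_sq`), and
  `∑_{i,i'} ∫ (∂ᵢ∂_{i'} P_Nθ)² = 16π⁴ ∑_{|k|≤N} |k|⁴ |θ̂(k)|²` (Parseval for trigonometric
  polynomials);
* the package `Torus.DEIJ.exists_truncated_datum` collecting these for the assembly.

[cite: DrivasEtAl2022, §3.3–3.4]; the Fourier facts are folklore (Grafakos, *Classical Fourier
Analysis*, Prop. 3.2.6–3.2.7, §3.3).

## Mathlib / tree search

Tree: `FunctionSpaces.Torus.scalarTruncate` with `integral_sq_scalarTruncate`,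
`integral_norm_sq_gradient_scalarTruncate`, `integral_sq_sub_scalarTruncate`,
`partialDeriv_reTrigPoly`, `integral_sq_reTrigPoly`, `IsConjSymmScalar.deriv` (`TorusScalarTrigPoly`,
`TorusTrigPoly`); `Torus.hasSum_sq_norm_mFourierCoeff_ofReal` (Parseval for real `L²` scalars);
`MemSobolev.memLp_two_holds` (`TorusSobolevNormProofs`),
`MemSobolev.summable_sobolevWeight_sq_mul_norm_sq` (`TorusSobolevNormEmbeddingProofs`);
`Torus.DEIJ.hess`, `partialDeriv_partialDeriv_eq_hess` (`DEIJShearStage`);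
`scalarGradNormSq_eq_sum_integral` (`PassiveScalarClassicalEnergy`). Mathlib:
`Real.sum_mul_le_sqrt_mul_sqrt`, `Finset.sum_mul_sq_le_sq_mul_sq`, `EuclideanSpace.basisFun`,
`hasSum_sum_of_ne_finset_zero`, `Finset.exists_max_image`.

## References

* T. D. Drivas, T. M. Elgindi, G. Iyer, I.-J. Jeong, *Anomalous dissipation in passive scalar
  transport*, Arch. Ration. Mech. Anal. 243 (2022) 1151–1180 (arXiv:1911.03271), §3.3–3.4.
  [`DrivasEtAl2022`]
* L. Grafakos, *Classical Fourier Analysis*, 3rd ed., GTM 249, Springer 2014, Prop. 3.2.6–3.2.7,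
  §3.3. [`Grafakos2014`]
-/

noncomputable section

open MeasureTheory TopologicalSpace Set Function Filter Topology UnitAddTorus
open scoped ENNReal NNReal InnerProductSpace ContDiff ComplexConjugate
open Literature.Analysis.FunctionSpaces.Torus
-- the coordinate partial derivative on the torus (`FunctionSpaces.Torus.partialDeriv`) is shadowed in
-- the namespace `Literature.Analysis.FluidPDE` by the Euclidean one; give it a local name
open Literature.Analysis.FunctionSpaces.Torus renaming partialDeriv → tPartialDeriv

namespace Literature.Analysis.FluidPDE

namespace Torus

namespace DEIJ

variable {d : Type*} [Fintype d] [DecidableEq d]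

/-! ## The datum in `L²`, mean zero of the truncation, the `L²` splitting -/

section Basic

omit [DecidableEq d] in
/-- An `H^s` real scalar, `s ≥ 0`, is in `L²` (`H^s ⊆ H⁰ = L²`, read through the
complexification). [folklore] -/
theorem memLp_two_of_memSobolev {s : ℝ} (hs : 0 ≤ s) {θ : UnitAddTorus d → ℝ}
    (hθ : MemSobolev s (fun x => (θ x : ℂ))) : MemLp θ 2 volume := by
  have h : MemLp (fun x => (θ x : ℂ)) 2 volume := MemSobolev.memLp_two_holds hθ hs
  have h2 := MemLp.re h
  simp only [RCLike.re_to_complex, Complex.ofReal_re] at h2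
  exact h2

omit [DecidableEq d] in
/-- The zeroth Fourier coefficient of a real scalar is its mean. [folklore] -/
theorem mFourierCoeff_ofReal_zero (θ : UnitAddTorus d → ℝ) :
    mFourierCoeff (fun x => (θ x : ℂ)) 0 = ((∫ x, θ x : ℝ) : ℂ) := by
  have h : ∀ t : UnitAddTorus d, mFourier (-(0 : d → ℤ)) t • ((θ t : ℝ) : ℂ) = ((θ t : ℝ) : ℂ) := fun t => by
    rw [neg_zero, mFourier_zero, ContinuousMap.one_apply, one_smul]
  simp only [mFourierCoeff_eq_integral_volume, h]
  exact integral_complex_ofReal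

omit [DecidableEq d] in
/-- A mean-zero real scalar has vanishing zeroth coefficient. [folklore] -/
theorem mFourierCoeff_ofReal_zero_eq_zero {θ : UnitAddTorus d → ℝ} (h0 : HasZeroMean θ) :
    mFourierCoeff (fun x => (θ x : ℂ)) 0 = 0 := by
  rw [mFourierCoeff_ofReal_zero, show (∫ x, θ x) = 0 from h0, Complex.ofReal_zero]

/-- **The truncation of a mean-zero scalar has zero mean** (its zeroth coefficient is `θ̂(0) = 0`).
[folklore] -/
theorem hasZeroMean_scalarTruncate {θ : UnitAddTorus d → ℝ} (h0 : HasZeroMean θ) (N : ℕ) :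
    HasZeroMean (scalarTruncate N θ) := by
  have h1 : mFourierCoeff (fun x => ((scalarTruncate N θ x : ℝ) : ℂ)) 0 = 0 := by
    rw [scalarTruncate, mFourierCoeff_ofReal_reTrigPoly neg_mem_freqBall_of_mem (isConjSymmScalar_mFourierCoeff θ),
      if_pos (zero_mem_freqBall N), mFourierCoeff_ofReal_zero_eq_zero h0]
  rw [mFourierCoeff_ofReal_zero] at h1
  exact_mod_cast h1

/-- **Orthogonal splitting of the energy**: `∫ θ² = ∫ (P_Nθ)² + ∫ (θ - P_Nθ)²` for `θ ∈ L²`.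
[folklore] -/
theorem integral_sq_scalarTruncate_add {θ : UnitAddTorus d → ℝ} (hθ : MemLp θ 2 volume) (N : ℕ) :
    (∫ x, scalarTruncate N θ x ^ 2) + ∫ x, (θ x - scalarTruncate N θ x) ^ 2 = ∫ x, θ x ^ 2 := by
  classical
  rw [integral_sq_sub_scalarTruncate hθ, integral_sq_scalarTruncate]
  ring

/-- The truncation does not increase the energy: `∫ (P_Nθ)² ≤ ∫ θ²` (Bessel). [folklore] -/
theorem integral_sq_scalarTruncate_le {θ : UnitAddTorus d → ℝ} (hθ : MemLp θ 2 volume) (N : ℕ) :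
    ∫ x, scalarTruncate N θ x ^ 2 ≤ ∫ x, θ x ^ 2 := by
  classical
  rw [integral_sq_scalarTruncate]
  exact sum_sq_norm_mFourierCoeff_le_integral_sq hθ N

/-- **The truncations recover the energy**: `∫ (P_Nθ)² → ∫ θ²`. [folklore] -/
theorem tendsto_integral_sq_scalarTruncate {θ : UnitAddTorus d → ℝ} (hθ : MemLp θ 2 volume) :
    Tendsto (fun N => ∫ x, scalarTruncate N θ x ^ 2) atTop (𝓝 (∫ x, θ x ^ 2)) := by
  have h := (tendsto_const_nhds (x := ∫ x, θ x ^ 2)).sub (tendsto_integral_sq_sub_scalarTruncate hθ)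
  rw [sub_zero] at h
  refine h.congr fun N => ?_
  linarith [integral_sq_scalarTruncate_add hθ N]

end Basic

/-! ## The `H²` tail: `N⁴ ∫ (θ - P_N θ)² → 0` -/

section Tail

omit [DecidableEq d] in
/-- The squared `H²` weight is `⟨k⟩⁴ = (1 + |k|²)²`. [folklore] -/
theorem sobolevWeight_two_sq (k : d → ℤ) : sobolevWeight 2 k ^ 2 = (1 + freqNormSq k) ^ 2 := by
  rw [sobolevWeight, show ((2 : ℝ) / 2) = 1 by norm_num, Real.rpow_one]

/-- The Parseval tail as a series: for `θ ∈ L²`, `∑_{|k| > N} |θ̂(k)|² = ∫ (θ - P_Nθ)²`. [folklore] -/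
theorem hasSum_tail_sq_norm_mFourierCoeff {θ : UnitAddTorus d → ℝ} (hθ : MemLp θ 2 volume) (N : ℕ) :
    HasSum (fun k : d → ℤ => if k ∈ freqBall N then 0 else ‖mFourierCoeff (fun x => (θ x : ℂ)) k‖ ^ 2)
      (∫ x, (θ x - scalarTruncate N θ x) ^ 2) := by
  classical
  set a : (d → ℤ) → ℝ := fun k => ‖mFourierCoeff (fun x => (θ x : ℂ)) k‖ ^ 2 with ha
  have h1 : HasSum a (∫ x, θ x ^ 2) := hasSum_sq_norm_mFourierCoeff_ofReal hθ
  have h2 : HasSum (fun k => if k ∈ freqBall N then a k else 0) (∑ k ∈ freqBall N, a k) := by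
    have h := hasSum_sum_of_ne_finset_zero (f := fun k => if k ∈ freqBall N then a k else 0)
      (s := freqBall N) (L := SummationFilter.unconditional _) (fun k hk => if_neg hk)
    rwa [Finset.sum_congr rfl fun k hk => if_pos hk] at h
  have h3 := h1.sub h2
  rw [integral_sq_sub_scalarTruncate hθ]
  refine h3.congr_fun fun k => ?_
  by_cases hk : k ∈ freqBall N <;> simp [hk, ha]

/-- **The `H²` tail bound**: for `θ ∈ H²(T^d)`,
`N⁴ ∫ (θ - P_Nθ)² ≤ ∑_{|k| > N} ⟨k⟩⁴ |θ̂(k)|²` (termwise: `N⁴ ≤ |k|⁴ ≤ ⟨k⟩⁴` off the ball).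
[folklore] -/
theorem pow_four_mul_integral_sq_sub_scalarTruncate_le {θ : UnitAddTorus d → ℝ}
    (hθ : MemSobolev 2 (fun x => (θ x : ℂ))) (N : ℕ) :
    (N : ℝ) ^ 4 * ∫ x, (θ x - scalarTruncate N θ x) ^ 2 ≤
      ∑' k : d → ℤ, if k ∈ freqBall N then 0 else
        sobolevWeight 2 k ^ 2 * ‖mFourierCoeff (fun x => (θ x : ℂ)) k‖ ^ 2 := by
  have hL2 : MemLp θ 2 volume := memLp_two_of_memSobolev (by norm_num) hθ
  have htail := hasSum_tail_sq_norm_mFourierCoeff hL2 N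
  have hsum := hθ.summable_sobolevWeight_sq_mul_norm_sq
  have hsum' : Summable fun k : d → ℤ => if k ∈ freqBall N then 0 else
      sobolevWeight 2 k ^ 2 * ‖mFourierCoeff (fun x => (θ x : ℂ)) k‖ ^ 2 := by
    refine Summable.of_nonneg_of_le (fun k => ?_) (fun k => ?_) hsum
    · split_ifs <;> positivity
    · split_ifs
      · positivity
      · exact le_rfl
  rw [← htail.tsum_eq, ← tsum_mul_left]
  refine Summable.tsum_le_tsum (fun k => ?_) (htail.summable.mul_left _) hsum'
  split_ifs with hk
  · simp
  · have hN : (N : ℝ) ^ 2 < freqNormSq k := not_mem_freqBall.1 hk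
    have hw : (N : ℝ) ^ 4 ≤ sobolevWeight 2 k ^ 2 := by
      rw [sobolevWeight_two_sq]
      have h0 : 0 ≤ freqNormSq k := freqNormSq_nonneg k
      nlinarith
    exact mul_le_mul_of_nonneg_right hw (sq_nonneg _)

/-- **`N⁴ ∫ (θ - P_N θ)² → 0` for `θ ∈ H²(T^d)`**: the approximation of an `H²` function by its
Fourier truncations is `o(N⁻²)` in `L²` (the tails of the convergent series `∑ ⟨k⟩⁴|θ̂(k)|²`
tend to zero along the exhausting balls). This is the only place where `θ₀ ∈ H²` (rather than
`L²`) enters the DEIJ argument for general data. [cite: DrivasEtAl2022, §3.4] -/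
theorem tendsto_pow_four_mul_integral_sq_sub_scalarTruncate {θ : UnitAddTorus d → ℝ}
    (hθ : MemSobolev 2 (fun x => (θ x : ℂ))) :
    Tendsto (fun N : ℕ => (N : ℝ) ^ 4 * ∫ x, (θ x - scalarTruncate N θ x) ^ 2) atTop (𝓝 0) := by
  have hL2 : MemLp θ 2 volume := memLp_two_of_memSobolev (by norm_num) hθ
  set w : (d → ℤ) → ℝ := fun k => sobolevWeight 2 k ^ 2 * ‖mFourierCoeff (fun x => (θ x : ℂ)) k‖ ^ 2
    with hw
  have hsum : Summable w := hθ.summable_sobolevWeight_sq_mul_norm_sq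
  have hw0 : ∀ k, 0 ≤ w k := fun k => by positivity
  -- the tails `T N = ∑' k, 1_{k ∉ ball N} w k = ∑' w - ∑_{ball N} w → 0`
  have htail : Tendsto (fun N : ℕ => ∑' k : d → ℤ, if k ∈ freqBall N then 0 else w k) atTop (𝓝 0) := by
    have h1 : Tendsto (fun N : ℕ => ∑ k ∈ freqBall N, w k) atTop (𝓝 (∑' k, w k)) :=
      hsum.hasSum.comp tendsto_freqBall_atTop
    have h2 := (tendsto_const_nhds (x := ∑' k, w k)).sub h1
    rw [sub_self] at h2
    refine h2.congr fun N => ?_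
    have hfin : HasSum (fun k => if k ∈ freqBall N then w k else 0) (∑ k ∈ freqBall N, w k) := by
      have h := hasSum_sum_of_ne_finset_zero (f := fun k => if k ∈ freqBall N then w k else 0)
        (s := freqBall N) (L := SummationFilter.unconditional _) (fun k hk => if_neg hk)
      rwa [Finset.sum_congr rfl fun k hk => if_pos hk] at h
    have h3 := hsum.hasSum.sub hfin
    rw [← h3.tsum_eq]
    refine tsum_congr fun k => ?_
    by_cases hk : k ∈ freqBall N <;> simp [hk]
  refine squeeze_zero (fun N => by positivity) (fun N => ?_) htail
  exact pow_four_mul_integral_sq_sub_scalarTruncate_le hθ N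

end Tail

/-! ## Poincaré and the dominant coordinate -/

section Poincare

/-- **Poincaré for the truncation of a mean-zero scalar**: `4π² ∫ (P_Nθ)² ≤ ∫ ‖∇P_Nθ‖²`
(on the Fourier side `|k|² ≥ 1` for `k ≠ 0` and `θ̂(0) = 0`). [folklore] -/
theorem four_pi_sq_mul_integral_sq_scalarTruncate_le {θ : UnitAddTorus d → ℝ} (h0 : HasZeroMean θ) (N : ℕ) :
    4 * Real.pi ^ 2 * ∫ x, scalarTruncate N θ x ^ 2 ≤
      ∫ x, ‖FunctionSpaces.Torus.gradient (scalarTruncate N θ) x‖ ^ 2 := by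
  rw [integral_sq_scalarTruncate, integral_norm_sq_gradient_scalarTruncate, Finset.mul_sum, Finset.mul_sum]
  refine Finset.sum_le_sum fun k _ => ?_
  by_cases hk : k = 0
  · subst hk
    rw [mFourierCoeff_ofReal_zero_eq_zero h0]
    simp
  · have h1 := one_le_freqNormSq_of_ne_zero hk
    have h2 : 0 ≤ ‖mFourierCoeff (fun x => (θ x : ℂ)) k‖ ^ 2 := sq_nonneg _
    have h3 : 0 ≤ 4 * Real.pi ^ 2 := by positivity
    calc 4 * Real.pi ^ 2 * ‖mFourierCoeff (fun x => (θ x : ℂ)) k‖ ^ 2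
        = 4 * Real.pi ^ 2 * (1 * ‖mFourierCoeff (fun x => (θ x : ℂ)) k‖ ^ 2) := by ring
      _ ≤ 4 * Real.pi ^ 2 * (freqNormSq k * ‖mFourierCoeff (fun x => (θ x : ℂ)) k‖ ^ 2) := by
          gcongr

omit [DecidableEq d] in
/-- `‖∇g‖²_{L²}` of `PassiveScalar` is the integral of the squared gradient norm. [folklore] -/
theorem scalarGradNormSq_eq_integral (g : UnitAddTorus d → ℝ) :
    scalarGradNormSq g = ∫ x, ‖FunctionSpaces.Torus.gradient g x‖ ^ 2 := rfl

/-- **A dominant coordinate**: for a smooth scalar `g` on `T^d` (`d` nonempty) there is a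
coordinate `p` with `‖∇g‖²_{L²} ≤ d · ∫ (∂_p g)²` (the largest of the `d` numbers `∫ (∂ᵢg)²`,
whose sum is `‖∇g‖²_{L²}`). [folklore] -/
theorem exists_dominant_coordinate [Nonempty d] {g : UnitAddTorus d → ℝ} (hg : IsSmooth g) :
    ∃ p : d, scalarGradNormSq g ≤ (Fintype.card d : ℝ) * ∫ x, tPartialDeriv p g x ^ 2 := by
  obtain ⟨p, -, hp⟩ := Finset.exists_max_image Finset.univ (fun i => ∫ x, tPartialDeriv i g x ^ 2)
    Finset.univ_nonempty
  refine ⟨p, ?_⟩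
  rw [scalarGradNormSq_eq_sum_integral hg]
  calc ∑ i, ∫ x, tPartialDeriv i g x ^ 2 ≤ ∑ _i : d, ∫ x, tPartialDeriv p g x ^ 2 :=
        Finset.sum_le_sum fun i _ => hp i (Finset.mem_univ i)
    _ = (Fintype.card d : ℝ) * ∫ x, tPartialDeriv p g x ^ 2 := by simp

omit [DecidableEq d] in
/-- With `2 ≤ card d` there is a second coordinate `q ≠ p`. [folklore] -/
theorem exists_ne_of_two_le_card (hd : 2 ≤ Fintype.card d) (p : d) : ∃ q : d, q ≠ p := by
  by_contra h
  push Not at h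
  have : Fintype.card d ≤ 1 := Fintype.card_le_one_iff.2 fun a b => (h a).trans (h b).symm
  omega

end Poincare

/-! ## The Hessian of a trigonometric polynomial -/

section Hessian

variable {g : UnitAddTorus d → ℝ}

/-- **All second partial derivatives are Hessian entries**: `∂ᵢ∂_{i'} g (x) = hess g x eᵢ e_{i'}`
(the mixed version of `partialDeriv_partialDeriv_eq_hess`). [folklore] -/
theorem partialDeriv_partialDeriv_eq_hess' (hg : IsSmooth g) (i i' : d) (x : UnitAddTorus d) :
    tPartialDeriv i (tPartialDeriv i' g) x =
      hess g x (EuclideanSpace.single i (1 : ℝ)) (EuclideanSpace.single i' (1 : ℝ)) := by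
  obtain ⟨y, rfl⟩ := proj_surjective x
  have hg1 : IsContDiff 1 g := hg.isContDiff (by simp)
  have hgi1 : IsContDiff 1 (tPartialDeriv i' g) := (hg.partialDeriv i').isContDiff (by simp)
  have e : lift (tPartialDeriv i' g) = fun y' => fderiv ℝ (lift g) y' (EuclideanSpace.single i' (1 : ℝ)) := by
    funext y'
    rw [lift_apply, partialDeriv_eq_fderiv_apply hg1, ← fderiv_lift]
  have hc : DifferentiableAt ℝ (fderiv ℝ (lift g)) y :=
    ((hg.fderiv_right (m := ∞) le_rfl).differentiable (by simp)).differentiableAt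
  rw [partialDeriv_eq_fderiv_apply hgi1, ← fderiv_lift, e, fderiv_clm_apply hc (differentiableAt_const _),
    fderiv_fun_const, hess_proj]
  simp

/-- Expansion of a vector of `ℝ^d` in the standard basis. [folklore] -/
theorem sum_apply_smul_single (v : EuclideanSpace ℝ d) :
    ∑ i, v i • EuclideanSpace.single i (1 : ℝ) = v := by
  have h := (EuclideanSpace.basisFun d ℝ).sum_repr v
  simpa [EuclideanSpace.basisFun_apply, EuclideanSpace.basisFun_repr] using h

/-- **Operator norm versus Hilbert–Schmidt norm** for a continuous bilinear form on `ℝ^d`: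
`‖B‖ ≤ (∑_{i,i'} B(eᵢ, e_{i'})²)^{1/2}` (two applications of Cauchy–Schwarz to
`B(v, w) = ∑_{i,i'} vᵢ w_{i'} B(eᵢ, e_{i'})`). [folklore] -/
theorem norm_bilin_le_sqrt_sum_sq (B : EuclideanSpace ℝ d →L[ℝ] EuclideanSpace ℝ d →L[ℝ] ℝ) :
    ‖B‖ ≤ Real.sqrt (∑ i, ∑ i', B (EuclideanSpace.single i (1 : ℝ)) (EuclideanSpace.single i' (1 : ℝ)) ^ 2) := by
  set b : d → d → ℝ := fun i i' => B (EuclideanSpace.single i (1 : ℝ)) (EuclideanSpace.single i' (1 : ℝ)) with hb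
  set M : ℝ := Real.sqrt (∑ i, ∑ i', b i i' ^ 2) with hM
  have hM0 : 0 ≤ M := Real.sqrt_nonneg _
  -- the bilinear expansion
  have hexp : ∀ v w : EuclideanSpace ℝ d, B v w = ∑ i, v i * ∑ i', w i' * b i i' := by
    intro v w
    have hv := sum_apply_smul_single v
    have hw := sum_apply_smul_single w
    have hBv : ∀ u, B v u = ∑ i, v i * B (EuclideanSpace.single i (1 : ℝ)) u := fun u => by
      conv_lhs => rw [← hv]
      rw [map_sum, FunLike.coe_sum, Finset.sum_apply]
      refine Finset.sum_congr rfl fun i _ => ?_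
      rw [map_smul, FunLike.coe_smul, Pi.smul_apply, smul_eq_mul]
    calc B v w = B v (∑ i', w i' • EuclideanSpace.single i' (1 : ℝ)) := by rw [hw]
      _ = ∑ i', w i' * B v (EuclideanSpace.single i' (1 : ℝ)) := by
          rw [map_sum]
          exact Finset.sum_congr rfl fun i' _ => by rw [map_smul, smul_eq_mul]
      _ = ∑ i', w i' * ∑ i, v i * b i i' := by
          refine Finset.sum_congr rfl fun i' _ => ?_
          rw [hBv]
      _ = ∑ i, v i * ∑ i', w i' * b i i' := by
          simp only [Finset.mul_sum]
          rw [Finset.sum_comm]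
          exact Finset.sum_congr rfl fun i _ => Finset.sum_congr rfl fun i' _ => by ring
  -- the pointwise bound `|B v w| ≤ M ‖v‖ ‖w‖`
  have hvw : ∀ v w : EuclideanSpace ℝ d, |B v w| ≤ M * ‖v‖ * ‖w‖ := by
    intro v w
    rw [hexp]
    have hv : Real.sqrt (∑ i, v i ^ 2) = ‖v‖ := by
      rw [EuclideanSpace.norm_eq]; simp [Real.norm_eq_abs, sq_abs]
    have hw' : ‖w‖ ^ 2 = ∑ i, w i ^ 2 := by
      rw [EuclideanSpace.norm_sq_eq]; simp [Real.norm_eq_abs, sq_abs]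
    -- inner Cauchy–Schwarz
    have hin : ∀ i, (∑ i', w i' * b i i') ^ 2 ≤ ‖w‖ ^ 2 * ∑ i', b i i' ^ 2 := fun i => by
      rw [hw']
      exact Finset.sum_mul_sq_le_sq_mul_sq Finset.univ (fun i' => w i') (fun i' => b i i')
    -- outer Cauchy–Schwarz
    have hCS := Real.sum_mul_le_sqrt_mul_sqrt Finset.univ (fun i => |v i|) (fun i => |∑ i', w i' * b i i'|)
    simp only [sq_abs] at hCS
    have h2 : Real.sqrt (∑ i, (∑ i', w i' * b i i') ^ 2) ≤ Real.sqrt (∑ i, ‖w‖ ^ 2 * ∑ i', b i i' ^ 2) :=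
      Real.sqrt_le_sqrt (Finset.sum_le_sum fun i _ => hin i)
    have h3 : Real.sqrt (∑ i, ‖w‖ ^ 2 * ∑ i', b i i' ^ 2) = ‖w‖ * M := by
      rw [← Finset.mul_sum, Real.sqrt_mul (sq_nonneg _), Real.sqrt_sq (norm_nonneg _)]
    have h4 : 0 ≤ Real.sqrt (∑ i, v i ^ 2) := Real.sqrt_nonneg _
    calc |∑ i, v i * ∑ i', w i' * b i i'|
        ≤ ∑ i, |v i * ∑ i', w i' * b i i'| := Finset.abs_sum_le_sum_abs _ _
      _ = ∑ i, |v i| * |∑ i', w i' * b i i'| := Finset.sum_congr rfl fun i _ => abs_mul _ _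
      _ ≤ Real.sqrt (∑ i, v i ^ 2) * Real.sqrt (∑ i, (∑ i', w i' * b i i') ^ 2) := hCS
      _ ≤ Real.sqrt (∑ i, v i ^ 2) * (‖w‖ * M) := by
          rw [← h3]; exact mul_le_mul_of_nonneg_left h2 h4
      _ = M * ‖v‖ * ‖w‖ := by rw [hv]; ring
  refine ContinuousLinearMap.opNorm_le_bound _ hM0 fun v => ?_
  refine ContinuousLinearMap.opNorm_le_bound _ (by positivity) fun w => ?_
  rw [Real.norm_eq_abs]
  exact hvw v w

/-- The Hessian operator norm is at most the Frobenius norm of the matrix of second partials: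
`‖hess g x‖² ≤ ∑_{i,i'} (∂ᵢ∂_{i'} g (x))²`. [folklore] -/
theorem norm_hess_sq_le_sum (hg : IsSmooth g) (x : UnitAddTorus d) :
    ‖hess g x‖ ^ 2 ≤ ∑ i, ∑ i', tPartialDeriv i (tPartialDeriv i' g) x ^ 2 := by
  have h := norm_bilin_le_sqrt_sum_sq (hess g x)
  have h0 : 0 ≤ ∑ i, ∑ i', (hess g x) (EuclideanSpace.single i (1 : ℝ)) (EuclideanSpace.single i' (1 : ℝ)) ^ 2 :=
    Finset.sum_nonneg fun i _ => Finset.sum_nonneg fun i' _ => sq_nonneg _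
  calc ‖hess g x‖ ^ 2 ≤ Real.sqrt (∑ i, ∑ i', (hess g x) (EuclideanSpace.single i (1 : ℝ))
        (EuclideanSpace.single i' (1 : ℝ)) ^ 2) ^ 2 := by gcongr
    _ = ∑ i, ∑ i', (hess g x) (EuclideanSpace.single i (1 : ℝ)) (EuclideanSpace.single i' (1 : ℝ)) ^ 2 :=
        Real.sq_sqrt h0
    _ = ∑ i, ∑ i', tPartialDeriv i (tPartialDeriv i' g) x ^ 2 := by
        simp_rw [partialDeriv_partialDeriv_eq_hess' hg]

/-- Second partials of a real trigonometric polynomial: `∂ᵢ∂_{i'} reTrigPoly S c =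
reTrigPoly S ((2πi kᵢ)(2πi k_{i'}) c)`. [folklore] -/
theorem partialDeriv_partialDeriv_reTrigPoly (S : Finset (d → ℤ)) (c : (d → ℤ) → ℂ) (i i' : d) :
    tPartialDeriv i (tPartialDeriv i' (reTrigPoly S c)) =
      reTrigPoly S (fun k => (2 * Real.pi * Complex.I * (k i)) • (2 * Real.pi * Complex.I * (k i')) • c k) := by
  have h1 : tPartialDeriv i' (reTrigPoly S c) = reTrigPoly S (fun k => (2 * Real.pi * Complex.I * (k i')) • c k) :=
    funext (partialDeriv_reTrigPoly S c i')
  rw [h1]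
  exact funext (partialDeriv_reTrigPoly S _ i)

/-- `∑_{i,i'} ∫ (∂ᵢ∂_{i'} reTrigPoly S c)² = 16π⁴ ∑_{k∈S} |k|⁴ |c k|²` (conjugate-symmetric `c`,
symmetric `S`; Parseval for each mixed derivative). [folklore] -/
theorem sum_integral_sq_partialDeriv_partialDeriv_reTrigPoly {S : Finset (d → ℤ)} (hS : ∀ k ∈ S, -k ∈ S)
    {c : (d → ℤ) → ℂ} (hc : IsConjSymmScalar c) :
    ∑ i, ∑ i', ∫ x, tPartialDeriv i (tPartialDeriv i' (reTrigPoly S c)) x ^ 2 =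
      16 * Real.pi ^ 4 * ∑ k ∈ S, freqNormSq k ^ 2 * ‖c k‖ ^ 2 := by
  have hterm : ∀ i i', ∫ x, tPartialDeriv i (tPartialDeriv i' (reTrigPoly S c)) x ^ 2 =
      ∑ k ∈ S, (16 * Real.pi ^ 4 * ((k i : ℝ) ^ 2 * (k i' : ℝ) ^ 2)) * ‖c k‖ ^ 2 := by
    intro i i'
    rw [partialDeriv_partialDeriv_reTrigPoly, integral_sq_reTrigPoly hS ((hc.deriv i').deriv i)]
    refine Finset.sum_congr rfl fun k _ => ?_
    rw [norm_smul, norm_smul, mul_pow, mul_pow]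
    have hn : ∀ j : d, ‖(2 * Real.pi * Complex.I * (k j) : ℂ)‖ = 2 * Real.pi * |(k j : ℝ)| := by
      intro j
      rw [norm_mul, norm_mul, norm_mul, Complex.norm_I, mul_one, Complex.norm_real, Complex.norm_ofNat,
        Real.norm_of_nonneg Real.pi_pos.le, Complex.norm_intCast]
    rw [hn i, hn i']
    simp only [mul_pow, sq_abs]
    ring
  have hk : ∀ k : d → ℤ, ∑ i, ∑ i', (16 * Real.pi ^ 4 * ((k i : ℝ) ^ 2 * (k i' : ℝ) ^ 2)) * ‖c k‖ ^ 2 =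
      16 * Real.pi ^ 4 * (freqNormSq k ^ 2 * ‖c k‖ ^ 2) := by
    intro k
    rw [freqNormSq, sq (∑ i, (k i : ℝ) ^ 2), Finset.sum_mul_sum]
    simp_rw [Finset.sum_mul, Finset.mul_sum]
    refine Finset.sum_congr rfl fun i _ => Finset.sum_congr rfl fun i' _ => ?_
    ring
  calc ∑ i, ∑ i', ∫ x, tPartialDeriv i (tPartialDeriv i' (reTrigPoly S c)) x ^ 2
      = ∑ i, ∑ i', ∑ k ∈ S, (16 * Real.pi ^ 4 * ((k i : ℝ) ^ 2 * (k i' : ℝ) ^ 2)) * ‖c k‖ ^ 2 := by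
        simp_rw [hterm]
    _ = ∑ i, ∑ k ∈ S, ∑ i', (16 * Real.pi ^ 4 * ((k i : ℝ) ^ 2 * (k i' : ℝ) ^ 2)) * ‖c k‖ ^ 2 :=
        Finset.sum_congr rfl fun i _ => Finset.sum_comm
    _ = ∑ k ∈ S, ∑ i, ∑ i', (16 * Real.pi ^ 4 * ((k i : ℝ) ^ 2 * (k i' : ℝ) ^ 2)) * ‖c k‖ ^ 2 :=
        Finset.sum_comm
    _ = ∑ k ∈ S, 16 * Real.pi ^ 4 * (freqNormSq k ^ 2 * ‖c k‖ ^ 2) := Finset.sum_congr rfl fun k _ => hk k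
    _ = 16 * Real.pi ^ 4 * ∑ k ∈ S, freqNormSq k ^ 2 * ‖c k‖ ^ 2 := by rw [Finset.mul_sum]

-- (the operator-norm instances on `ℝ^d →L ℝ^d →L ℝ` need the deeper pending depth, as in `DEIJShearStage`)
set_option maxSynthPendingDepth 2 in
/-- **The Hessian of the truncation**: `∫ ‖hess (P_Nθ)‖² ≤ 16π⁴ N⁴ ∫ (P_Nθ)²` — a trigonometric
polynomial of degree `N` has `‖D²·‖_{L²} ≤ 4π²N² ‖·‖_{L²}` (operator norm `≤` Hilbert–Schmidt norm
pointwise, then Parseval: `∑_{i,i'} ∫ (∂ᵢ∂_{i'}P_Nθ)² = 16π⁴ ∑_{|k|≤N} |k|⁴|θ̂(k)|² ≤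
16π⁴N⁴ ∑_{|k|≤N} |θ̂(k)|²`). [folklore] -/
theorem integral_norm_hess_scalarTruncate_sq_le (θ : UnitAddTorus d → ℝ) (N : ℕ) :
    ∫ x, ‖hess (scalarTruncate N θ) x‖ ^ 2 ≤
      16 * Real.pi ^ 4 * (N : ℝ) ^ 4 * ∫ x, scalarTruncate N θ x ^ 2 := by
  have hg : IsSmooth (scalarTruncate N θ) := isSmooth_scalarTruncate N θ
  have hc : IsConjSymmScalar (fun k => mFourierCoeff (fun x => (θ x : ℂ)) k) := isConjSymmScalar_mFourierCoeff θ
  -- integrability of the two sides of the pointwise bound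
  have hi1 : Integrable (fun x => ‖hess (scalarTruncate N θ) x‖ ^ 2) volume :=
    ((continuous_hess hg).norm.pow 2).integrable_unitAddTorus
  have hcont : ∀ i i', Continuous fun x => tPartialDeriv i (tPartialDeriv i' (scalarTruncate N θ)) x ^ 2 :=
    fun i i' => ((hg.partialDeriv i').partialDeriv i).continuous.pow 2
  have hi2 : Integrable (fun x => ∑ i, ∑ i', tPartialDeriv i (tPartialDeriv i' (scalarTruncate N θ)) x ^ 2) volume :=
    integrable_finsetSum _ fun i _ => integrable_finsetSum _ fun i' _ => (hcont i i').integrable_unitAddTorus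
  have h1 : ∫ x, ‖hess (scalarTruncate N θ) x‖ ^ 2 ≤
      ∑ i, ∑ i', ∫ x, tPartialDeriv i (tPartialDeriv i' (scalarTruncate N θ)) x ^ 2 := by
    calc ∫ x, ‖hess (scalarTruncate N θ) x‖ ^ 2
        ≤ ∫ x, ∑ i, ∑ i', tPartialDeriv i (tPartialDeriv i' (scalarTruncate N θ)) x ^ 2 :=
          integral_mono hi1 hi2 fun x => norm_hess_sq_le_sum hg x
      _ = ∑ i, ∫ x, ∑ i', tPartialDeriv i (tPartialDeriv i' (scalarTruncate N θ)) x ^ 2 :=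
          integral_finsetSum _ fun i _ => integrable_finsetSum _ fun i' _ => (hcont i i').integrable_unitAddTorus
      _ = ∑ i, ∑ i', ∫ x, tPartialDeriv i (tPartialDeriv i' (scalarTruncate N θ)) x ^ 2 :=
          Finset.sum_congr rfl fun i _ => integral_finsetSum _ fun i' _ => (hcont i i').integrable_unitAddTorus
  have h2 : ∑ i, ∑ i', ∫ x, tPartialDeriv i (tPartialDeriv i' (scalarTruncate N θ)) x ^ 2 =
      16 * Real.pi ^ 4 * ∑ k ∈ freqBall N, freqNormSq k ^ 2 * ‖mFourierCoeff (fun x => (θ x : ℂ)) k‖ ^ 2 :=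
    sum_integral_sq_partialDeriv_partialDeriv_reTrigPoly neg_mem_freqBall_of_mem hc
  have h3 : ∑ k ∈ freqBall N, freqNormSq k ^ 2 * ‖mFourierCoeff (fun x => (θ x : ℂ)) k‖ ^ 2 ≤
      ∑ k ∈ freqBall N, ((N : ℝ) ^ 2) ^ 2 * ‖mFourierCoeff (fun x => (θ x : ℂ)) k‖ ^ 2 :=
    Finset.sum_le_sum fun k hk => mul_le_mul_of_nonneg_right
      (pow_le_pow_left₀ (freqNormSq_nonneg k) (mem_freqBall.1 hk) 2) (sq_nonneg _)
  have h4 : ∑ k ∈ freqBall N, ((N : ℝ) ^ 2) ^ 2 * ‖mFourierCoeff (fun x => (θ x : ℂ)) k‖ ^ 2 =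
      (N : ℝ) ^ 4 * ∫ x, scalarTruncate N θ x ^ 2 := by
    rw [integral_sq_scalarTruncate, Finset.mul_sum]
    refine Finset.sum_congr rfl fun k _ => ?_
    ring
  have hπ : 0 ≤ 16 * Real.pi ^ 4 := by positivity
  calc ∫ x, ‖hess (scalarTruncate N θ) x‖ ^ 2
      ≤ 16 * Real.pi ^ 4 * ∑ k ∈ freqBall N, freqNormSq k ^ 2 * ‖mFourierCoeff (fun x => (θ x : ℂ)) k‖ ^ 2 :=
        h1.trans_eq h2
    _ ≤ 16 * Real.pi ^ 4 * ((N : ℝ) ^ 4 * ∫ x, scalarTruncate N θ x ^ 2) := by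
        rw [← h4]; exact mul_le_mul_of_nonneg_left h3 hπ
    _ = 16 * Real.pi ^ 4 * (N : ℝ) ^ 4 * ∫ x, scalarTruncate N θ x ^ 2 := by ring

end Hessian

/-! ## The datum package -/

section Package

/-- **The truncated datum of the DEIJ cascade.** For a mean-zero real `θ ∈ H²(T^d)` and every
`η > 0` there is a degree `N ≥ 1` such that `g₀ = P_N θ` (smooth, mean zero, a trigonometric
polynomial of degree `N`) satisfies: `∫ g₀² ≤ ∫ θ²` and `∫ θ² ≤ ∫ g₀² + η` (energy recovered up to
`η`), the Poincaré bound `4π² ∫ g₀² ≤ ‖∇g₀‖²_{L²}`, the Hessian bound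
`∫ ‖hess g₀‖² ≤ 16π⁴N⁴ ∫ g₀²`, and the `H²` tail bound `N⁴ ∫ (θ - g₀)² ≤ η`. (With the cascade's
balanced-growth constant `C ≲ N²`, the last bound is what makes `8C² ∫ (θ - g₀)²` small.)
[cite: DrivasEtAl2022, §3.4] -/
theorem exists_truncated_datum {θ : UnitAddTorus d → ℝ} (hθ : MemSobolev 2 (fun x => (θ x : ℂ)))
    (h0 : HasZeroMean θ) {η : ℝ} (hη : 0 < η) :
    ∃ N : ℕ, 1 ≤ N ∧
      IsSmooth (scalarTruncate N θ) ∧ HasZeroMean (scalarTruncate N θ) ∧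
      (∫ x, scalarTruncate N θ x ^ 2 ≤ ∫ x, θ x ^ 2) ∧
      (∫ x, θ x ^ 2 ≤ (∫ x, scalarTruncate N θ x ^ 2) + η) ∧
      4 * Real.pi ^ 2 * (∫ x, scalarTruncate N θ x ^ 2) ≤ scalarGradNormSq (scalarTruncate N θ) ∧
      (∫ x, ‖hess (scalarTruncate N θ) x‖ ^ 2 ≤
        16 * Real.pi ^ 4 * (N : ℝ) ^ 4 * ∫ x, scalarTruncate N θ x ^ 2) ∧
      (N : ℝ) ^ 4 * ∫ x, (θ x - scalarTruncate N θ x) ^ 2 ≤ η := by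
  have hL2 : MemLp θ 2 volume := memLp_two_of_memSobolev (by norm_num) hθ
  have h1 : ∀ᶠ N : ℕ in atTop, (N : ℝ) ^ 4 * ∫ x, (θ x - scalarTruncate N θ x) ^ 2 ≤ η :=
    (tendsto_pow_four_mul_integral_sq_sub_scalarTruncate hθ).eventually (Iic_mem_nhds hη)
  have h2 : ∀ᶠ N : ℕ in atTop, ∫ x, (θ x - scalarTruncate N θ x) ^ 2 ≤ η :=
    (tendsto_integral_sq_sub_scalarTruncate hL2).eventually (Iic_mem_nhds hη)
  obtain ⟨N, hN1, hN2, hN3⟩ := (h1.and (h2.and (eventually_ge_atTop 1))).exists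
  refine ⟨N, hN3, isSmooth_scalarTruncate N θ, hasZeroMean_scalarTruncate h0 N,
    integral_sq_scalarTruncate_le hL2 N, ?_, ?_, integral_norm_hess_scalarTruncate_sq_le θ N, hN1⟩
  · linarith [integral_sq_scalarTruncate_add hL2 N]
  · rw [scalarGradNormSq_eq_integral]
    exact four_pi_sq_mul_integral_sq_scalarTruncate_le h0 N

end Package

end DEIJ

end Torus

end Literature.Analysis.FluidPDE
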